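import Mathlib
import Summits.NavierStokesRegularity.NavierStokesRegularity.Theorems.SubcriticalEnvelopeForwardSourceSmoothingShell
import HarnessLib

/-!
# `SubcriticalEnvelope.ForwardSourceSmoothing` (stmt-NavierStokesRegularity-26374, crux B⁺) — stage γ₂:
the finitely many shells below the crossover, and the tail-sum bookkeeping (helper file,
`--supports`)

Below the `ν`-dependent crossover shell `n₁` the dissipation does not dominate, but only finitely
many shells are concerned: the growth-regime bound of stage β
(`forwardSourceSmoothing_shell_growth`), with its constants majorised uniformly in `k ≤ n₁`
(`forwardSourceSmoothing_shell_near`), is iterated DOWNWARD from the far-shell bound at `k = n₁`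
along any majorising sequence `Λ_{j+1} ≥ (e₀ + c_max(Λ_j)²T/2)·e^{(r_max+1)T}`
(`forwardSourceSmoothing_near_shells`), giving solution-independent bounds `y_{n₁−j} ≤ Λ_j`.
Finally `forwardSourceSmoothing_tail_sum_le` packages near and far bounds into a subcritical
geometric envelope `Σ_{k=n}^{N} y_k ≤ K_D (1+ε₀)^{-2γn}` for the partial tail sums.

HONEST FRAMING: estimates for Tao-type MODEL lattice ODEs (Tao 2016 §4; BMR 2011 §3 type bootstrap);
nothing here bears on the Navier–Stokes equations; no summit is proved.
-/

noncomputable section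

-- the sub-problem namespace `NavierStokesRegularity.NavierStokesRegularity` is the tree's layout (D-0017)
set_option linter.dupNamespace false

namespace Summit.NavierStokesRegularity.NavierStokesRegularity.Theorems

open Set Finset
open Literature.Analysis.FluidPDE.TaoCascade

variable {m : ℕ}

/-! ## One shell below the crossover -/

/-- **Growth bound with shell-uniform constants.** For a regular solution on `[0,s]` (vanishing below
shell `0`), sources bounded by `A(1+ε₀)^{-γk}` (`γ ≥ 0`), a shell `k ≤ n₁` and an energy bound `Λ'`
for the non-source modes of shell `k+1`, the non-source energy of shell `k` obeys
`y_k(t) ≤ (y_k(0) + c_max²·s/2)·e^{(r_max+1)s}` with the `k`-INDEPENDENT constants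
`r_max = 4m³M_α(1+ε₀)^{5n₁/2}A`, `c_max = m³M_α(1+ε₀)^{5n₁/2}(4A² + 2A√(2Λ') + A²(1+ε₀)^{2γ})`.
[cite: Tao2016AveragedNS, §4 (4.8)–(4.9); Teschl2012, §2.4] -/
theorem forwardSourceSmoothing_shell_near {ε₀ ν Mα A γ s Λ' : ℝ} {n₁ k : ℕ} (hε₀ : 0 < ε₀)
    (hν : 0 ≤ ν) (hMα : 0 ≤ Mα) (hA : 0 ≤ A) (hγ : 0 ≤ γ)
    {α : Fin m → Fin m → Fin m → ℤ × ℤ × ℤ → ℝ} (hs : IsSymmetricCoeff α) (hc : IsCancellingCoeff α)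
    (hα : ∀ i₁ i₂ i₃ μ, μ ∈ shiftSet → |α i₁ i₂ i₃ μ| ≤ Mα)
    (S : Finset (Fin m)) (hS : ∀ i, i ∉ S → ∀ j l : Fin m, α i j l (0, 0, 1) = 0)
    {X : Fin m → ℤ → ℝ → ℝ} (hlow : ∀ i (k : ℤ), k < 0 → ∀ t, X i k t = 0)
    (hcont : ∀ i k, Continuous (X i k))
    (hder : ∀ i k, ∀ t ∈ Icc (0 : ℝ) s, HasDerivWithinAt (X i k)
      (quadTerm ε₀ α X i k t - ν * (1 + ε₀) ^ ((2 : ℝ) * k) * X i k t) (Icc 0 s) t)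
    (hSb : ∀ (k : ℕ), ∀ t ∈ Icc (0 : ℝ) s, ∀ i ∈ S, |X i k t| ≤ A * (1 + ε₀) ^ (-(γ * (k : ℝ))))
    (hkn : k ≤ n₁)
    (hup : ∀ t ∈ Icc (0 : ℝ) s, ∑ d ∈ Sᶜ, (1 / 2 : ℝ) * X d ((k : ℤ) + 1) t ^ 2 ≤ Λ') :
    ∀ t ∈ Icc (0 : ℝ) s, ∑ d ∈ Sᶜ, (1 / 2 : ℝ) * X d k t ^ 2 ≤
      (∑ d ∈ Sᶜ, (1 / 2 : ℝ) * X d k 0 ^ 2 +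
        ((m : ℝ) ^ 3 * Mα * (1 + ε₀) ^ ((5 : ℝ) * (n₁ : ℝ) / 2) *
            (4 * A ^ 2 + 2 * A * Real.sqrt (2 * Λ') + A ^ 2 * (1 + ε₀) ^ (2 * γ))) ^ 2 / 2 * s) *
      Real.exp ((4 * ((m : ℝ) ^ 3 * Mα) * (1 + ε₀) ^ ((5 : ℝ) * (n₁ : ℝ) / 2) * A + 1) * s) := by
  intro t ht
  set b : ℝ := 1 + ε₀ with hb
  have hb1 : 1 ≤ b := by rw [hb]; linarith
  have hb0 : 0 < b := by linarith
  set L : ℝ := (m : ℝ) ^ 3 * Mα with hL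
  have hL0 : 0 ≤ L := by positivity
  set u : ℝ := b ^ (-(γ * (k : ℝ))) with hu
  have hu0 : 0 ≤ u := Real.rpow_nonneg hb0.le _
  have hu1 : u ≤ 1 := Real.rpow_le_one_of_one_le_of_nonpos hb1 (by
    have : (0 : ℝ) ≤ k := Nat.cast_nonneg k; nlinarith)
  have hs0 : 0 ≤ s := ht.1.trans ht.2
  -- source bounds on the three shells, in the form of the growth lemma
  have hS0 : ∀ τ ∈ Icc (0 : ℝ) s, ∀ i ∈ S, |X i (k : ℤ) τ| ≤ A * u := fun τ hτ i hi =>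
    hSb k τ hτ i hi
  have hS1 : ∀ τ ∈ Icc (0 : ℝ) s, ∀ i ∈ S, |X i ((k : ℤ) + 1) τ| ≤ A * b ^ (-(γ * ((k : ℝ) + 1))) := by
    intro τ hτ i hi
    have h := hSb (k + 1) τ hτ i hi
    have hcast : (((k + 1 : ℕ) : ℤ)) = (k : ℤ) + 1 := by push_cast; ring
    rw [hcast] at h
    simpa using h
  have hSm : ∀ τ ∈ Icc (0 : ℝ) s, ∀ i ∈ S, |X i ((k : ℤ) - 1) τ| ≤ A * b ^ γ * u := by
    intro τ hτ i hi
    rcases Nat.eq_zero_or_pos k with hk0 | hkpos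
    · subst hk0
      rw [show ((0 : ℕ) : ℤ) - 1 = -1 by norm_num, hlow i (-1) (by norm_num) τ, abs_zero]
      positivity
    · have h := hSb (k - 1) τ hτ i hi
      have hcast : (((k - 1 : ℕ) : ℤ)) = (k : ℤ) - 1 := by omega
      rw [hcast] at h
      refine h.trans (le_of_eq ?_)
      rw [hu, mul_assoc, ← Real.rpow_add hb0, Nat.cast_sub hkpos]
      push_cast
      ring_nf
  have h10 : A * b ^ (-(γ * ((k : ℝ) + 1))) ≤ A * u :=
    mul_le_mul_of_nonneg_left (Real.rpow_le_rpow_of_exponent_le hb1 (by nlinarith)) hA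
  have hgrowth := forwardSourceSmoothing_shell_growth (k := (k : ℤ)) hb0.le hMα hs hc hα S hS hν
    hcont hder (by positivity) (by positivity) (by positivity) h10 hS0 hS1 hSm hup t ht
  push_cast at hgrowth
  -- majorise the constants uniformly in `k ≤ n₁`
  have hPk : b ^ ((5 : ℝ) * (k : ℝ) / 2) ≤ b ^ ((5 : ℝ) * (n₁ : ℝ) / 2) :=
    Real.rpow_le_rpow_of_exponent_le hb1 (by
      have : (k : ℝ) ≤ n₁ := by exact_mod_cast hkn
      linarith)
  have hQk : b ^ ((5 : ℝ) * ((k : ℝ) - 1) / 2) ≤ b ^ ((5 : ℝ) * (n₁ : ℝ) / 2) :=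
    Real.rpow_le_rpow_of_exponent_le hb1 (by
      have : (k : ℝ) ≤ n₁ := by exact_mod_cast hkn
      linarith)
  have hP0 : 0 ≤ b ^ ((5 : ℝ) * (k : ℝ) / 2) := Real.rpow_nonneg hb0.le _
  have hQ0 : 0 ≤ b ^ ((5 : ℝ) * ((k : ℝ) - 1) / 2) := Real.rpow_nonneg hb0.le _
  have hAu : (A * u) ^ 2 ≤ A ^ 2 := by
    rw [mul_pow]; exact mul_le_of_le_one_right (sq_nonneg A) (by nlinarith)
  have hAgu : (A * b ^ γ * u) ^ 2 ≤ A ^ 2 * b ^ (2 * γ) := by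
    have : (A * b ^ γ * u) ^ 2 = A ^ 2 * b ^ (2 * γ) * u ^ 2 := by
      rw [mul_pow, mul_pow, sq (b ^ γ), ← Real.rpow_add hb0]; ring_nf
    rw [this]
    exact mul_le_of_le_one_right (by positivity) (by nlinarith)
  have hW0 : 0 ≤ Real.sqrt (2 * Λ') := Real.sqrt_nonneg _
  -- `c_k ≤ c_max`
  have hAu1 : A * u ≤ A := mul_le_of_le_one_right hA hu1
  have hPn0 : 0 ≤ b ^ ((5 : ℝ) * (n₁ : ℝ) / 2) := hP0.trans hPk
  have t1 : 4 * b ^ ((5 : ℝ) * (k : ℝ) / 2) * (A * u) ^ 2 ≤ 4 * b ^ ((5 : ℝ) * (n₁ : ℝ) / 2) * A ^ 2 :=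
    mul_le_mul (mul_le_mul_of_nonneg_left hPk (by norm_num)) hAu (sq_nonneg _) (by positivity)
  have t2 : 2 * b ^ ((5 : ℝ) * (k : ℝ) / 2) * (A * u) * Real.sqrt (2 * Λ') ≤
      2 * b ^ ((5 : ℝ) * (n₁ : ℝ) / 2) * A * Real.sqrt (2 * Λ') :=
    mul_le_mul_of_nonneg_right (mul_le_mul (mul_le_mul_of_nonneg_left hPk two_pos.le) hAu1
      (by positivity) (by positivity)) hW0
  have t3 : b ^ ((5 : ℝ) * ((k : ℝ) - 1) / 2) * (A * b ^ γ * u) ^ 2 ≤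
      b ^ ((5 : ℝ) * (n₁ : ℝ) / 2) * (A ^ 2 * b ^ (2 * γ)) :=
    mul_le_mul hQk hAgu (sq_nonneg _) hPn0
  have hcle : L * (4 * b ^ ((5 : ℝ) * (k : ℝ) / 2) * (A * u) ^ 2 +
        2 * b ^ ((5 : ℝ) * (k : ℝ) / 2) * (A * u) * Real.sqrt (2 * Λ') +
        b ^ ((5 : ℝ) * ((k : ℝ) - 1) / 2) * (A * b ^ γ * u) ^ 2) ≤
      L * b ^ ((5 : ℝ) * (n₁ : ℝ) / 2) * (4 * A ^ 2 + 2 * A * Real.sqrt (2 * Λ') +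
        A ^ 2 * b ^ (2 * γ)) := by
    have e : L * b ^ ((5 : ℝ) * (n₁ : ℝ) / 2) * (4 * A ^ 2 + 2 * A * Real.sqrt (2 * Λ') +
        A ^ 2 * b ^ (2 * γ)) = L * (4 * b ^ ((5 : ℝ) * (n₁ : ℝ) / 2) * A ^ 2 +
        2 * b ^ ((5 : ℝ) * (n₁ : ℝ) / 2) * A * Real.sqrt (2 * Λ') +
        b ^ ((5 : ℝ) * (n₁ : ℝ) / 2) * (A ^ 2 * b ^ (2 * γ))) := by ring
    rw [e]
    exact mul_le_mul_of_nonneg_left (add_le_add (add_le_add t1 t2) t3) hL0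
  have hc0 : 0 ≤ L * (4 * b ^ ((5 : ℝ) * (k : ℝ) / 2) * (A * u) ^ 2 +
        2 * b ^ ((5 : ℝ) * (k : ℝ) / 2) * (A * u) * Real.sqrt (2 * Λ') +
        b ^ ((5 : ℝ) * ((k : ℝ) - 1) / 2) * (A * b ^ γ * u) ^ 2) := by positivity
  -- `r_k ≤ r_max`
  have hrle : 4 * L * b ^ ((5 : ℝ) * (k : ℝ) / 2) * (A * u) ≤ 4 * L * b ^ ((5 : ℝ) * (n₁ : ℝ) / 2) * A :=
    mul_le_mul (mul_le_mul_of_nonneg_left hPk (by positivity)) hAu1 (by positivity) (by positivity)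
  -- monotonicity of the Grönwall bound in the constants
  have hy00 : 0 ≤ ∑ d ∈ Sᶜ, (1 / 2 : ℝ) * X d (k : ℤ) 0 ^ 2 := Finset.sum_nonneg fun d _ => by positivity
  refine hgrowth.trans ?_
  have hsq : (L * (4 * b ^ ((5 : ℝ) * (k : ℝ) / 2) * (A * u) ^ 2 +
        2 * b ^ ((5 : ℝ) * (k : ℝ) / 2) * (A * u) * Real.sqrt (2 * Λ') +
        b ^ ((5 : ℝ) * ((k : ℝ) - 1) / 2) * (A * b ^ γ * u) ^ 2)) ^ 2 ≤
      (L * b ^ ((5 : ℝ) * (n₁ : ℝ) / 2) * (4 * A ^ 2 + 2 * A * Real.sqrt (2 * Λ') +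
        A ^ 2 * b ^ (2 * γ))) ^ 2 := pow_le_pow_left₀ hc0 hcle 2
  have hE : Real.exp ((4 * L * b ^ ((5 : ℝ) * (k : ℝ) / 2) * (A * u) + 1) * s) ≤
      Real.exp ((4 * L * b ^ ((5 : ℝ) * (n₁ : ℝ) / 2) * A + 1) * s) :=
    Real.exp_le_exp.2 (mul_le_mul_of_nonneg_right (by linarith) hs0)
  have hfac : ∑ d ∈ Sᶜ, (1 / 2 : ℝ) * X d (k : ℤ) 0 ^ 2 +
        (L * (4 * b ^ ((5 : ℝ) * (k : ℝ) / 2) * (A * u) ^ 2 +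
          2 * b ^ ((5 : ℝ) * (k : ℝ) / 2) * (A * u) * Real.sqrt (2 * Λ') +
          b ^ ((5 : ℝ) * ((k : ℝ) - 1) / 2) * (A * b ^ γ * u) ^ 2)) ^ 2 / 2 * s ≤
      ∑ d ∈ Sᶜ, (1 / 2 : ℝ) * X d (k : ℤ) 0 ^ 2 +
        (L * b ^ ((5 : ℝ) * (n₁ : ℝ) / 2) * (4 * A ^ 2 + 2 * A * Real.sqrt (2 * Λ') +
          A ^ 2 * b ^ (2 * γ))) ^ 2 / 2 * s := by
    have := mul_le_mul_of_nonneg_right (div_le_div_of_nonneg_right hsq two_pos.le) hs0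
    linarith
  exact mul_le_mul hfac hE (Real.exp_pos _).le (by positivity)

/-! ## Downward recursion over the near shells -/

/-- **The near shells, by downward induction from the crossover.** In the setting of
`forwardSourceSmoothing_shell_near` on a window `[0,s] ⊆ [0,T]`, let `e₀` bound every initial
non-source energy `y_k(0)`, let `y_{n₁}(t) ≤ Λ₀` on `[0,s]`, and let `Λ` be any sequence
with `(e₀ + c_max(Λ_j)²T/2)·e^{(r_max+1)T} ≤ Λ_{j+1}`.  Then `y_{n₁−j}(t) ≤ Λ_j` for all `j ≤ n₁`
and `t ∈ [0,s]`.  [cite: Tao2016AveragedNS, §4 (4.8)–(4.9); Teschl2012, §2.4] -/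
theorem forwardSourceSmoothing_near_shells {ε₀ ν Mα A γ s T e₀ : ℝ} {n₁ : ℕ} (hε₀ : 0 < ε₀)
    (hν : 0 ≤ ν) (hMα : 0 ≤ Mα) (hA : 0 ≤ A) (hγ : 0 ≤ γ) (hsT : s ≤ T)
    {α : Fin m → Fin m → Fin m → ℤ × ℤ × ℤ → ℝ} (hs : IsSymmetricCoeff α) (hc : IsCancellingCoeff α)
    (hα : ∀ i₁ i₂ i₃ μ, μ ∈ shiftSet → |α i₁ i₂ i₃ μ| ≤ Mα)
    (S : Finset (Fin m)) (hS : ∀ i, i ∉ S → ∀ j l : Fin m, α i j l (0, 0, 1) = 0)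
    {X : Fin m → ℤ → ℝ → ℝ} (hlow : ∀ i (k : ℤ), k < 0 → ∀ t, X i k t = 0)
    (hcont : ∀ i k, Continuous (X i k))
    (hder : ∀ i k, ∀ t ∈ Icc (0 : ℝ) s, HasDerivWithinAt (X i k)
      (quadTerm ε₀ α X i k t - ν * (1 + ε₀) ^ ((2 : ℝ) * k) * X i k t) (Icc 0 s) t)
    (hSb : ∀ (k : ℕ), ∀ t ∈ Icc (0 : ℝ) s, ∀ i ∈ S, |X i k t| ≤ A * (1 + ε₀) ^ (-(γ * (k : ℝ))))
    (he₀ : ∀ k : ℕ, ∑ d ∈ Sᶜ, (1 / 2 : ℝ) * X d k 0 ^ 2 ≤ e₀)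
    (Λ : ℕ → ℝ)
    (hfar : ∀ t ∈ Icc (0 : ℝ) s, ∑ d ∈ Sᶜ, (1 / 2 : ℝ) * X d (n₁ : ℕ) t ^ 2 ≤ Λ 0)
    (hstep : ∀ j, (e₀ + ((m : ℝ) ^ 3 * Mα * (1 + ε₀) ^ ((5 : ℝ) * (n₁ : ℝ) / 2) *
        (4 * A ^ 2 + 2 * A * Real.sqrt (2 * Λ j) + A ^ 2 * (1 + ε₀) ^ (2 * γ))) ^ 2 / 2 * T) *
      Real.exp ((4 * ((m : ℝ) ^ 3 * Mα) * (1 + ε₀) ^ ((5 : ℝ) * (n₁ : ℝ) / 2) * A + 1) * T) ≤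
        Λ (j + 1)) :
    ∀ j : ℕ, j ≤ n₁ → ∀ t ∈ Icc (0 : ℝ) s, ∑ d ∈ Sᶜ, (1 / 2 : ℝ) * X d ((n₁ - j : ℕ) : ℤ) t ^ 2 ≤ Λ j := by
  intro j
  induction j with
  | zero => intro _ t ht; simpa using hfar t ht
  | succ j ih =>
    intro hj t ht
    have hs0 : 0 ≤ s := ht.1.trans ht.2
    set k : ℕ := n₁ - (j + 1) with hk
    have hk1 : ((n₁ - j : ℕ) : ℤ) = (k : ℤ) + 1 := by omega
    have hup : ∀ τ ∈ Icc (0 : ℝ) s, ∑ d ∈ Sᶜ, (1 / 2 : ℝ) * X d ((k : ℤ) + 1) τ ^ 2 ≤ Λ j := by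
      intro τ hτ; rw [← hk1]; exact ih (by omega) τ hτ
    have h := forwardSourceSmoothing_shell_near hε₀ hν hMα hA hγ hs hc hα S hS hlow hcont hder hSb
      (show k ≤ n₁ by omega) hup t ht
    refine h.trans (le_trans ?_ (hstep j))
    -- monotonicity in `s ≤ T` and `y_k(0) ≤ e₀`
    have hc2 : 0 ≤ ((m : ℝ) ^ 3 * Mα * (1 + ε₀) ^ ((5 : ℝ) * (n₁ : ℝ) / 2) *
        (4 * A ^ 2 + 2 * A * Real.sqrt (2 * Λ j) + A ^ 2 * (1 + ε₀) ^ (2 * γ))) ^ 2 / 2 := by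
      positivity
    have hr0 : 0 ≤ 4 * ((m : ℝ) ^ 3 * Mα) * (1 + ε₀) ^ ((5 : ℝ) * (n₁ : ℝ) / 2) * A + 1 := by
      have : 0 ≤ (1 + ε₀) ^ ((5 : ℝ) * (n₁ : ℝ) / 2) := Real.rpow_nonneg (by linarith) _
      positivity
    have hfac := add_le_add (he₀ k) (mul_le_mul_of_nonneg_left hsT hc2)
    have hE := Real.exp_le_exp.2 (mul_le_mul_of_nonneg_left hsT hr0)
    have hy00 : 0 ≤ ∑ d ∈ Sᶜ, (1 / 2 : ℝ) * X d (k : ℤ) 0 ^ 2 :=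
      Finset.sum_nonneg fun d _ => by positivity
    exact mul_le_mul hfac hE (Real.exp_pos _).le
      (add_nonneg (hy00.trans (he₀ k)) (mul_nonneg hc2 (hs0.trans hsT)))

/-! ## Tail-sum bookkeeping -/

/-- **Near and far bounds give a subcritical envelope for the partial tail sums.** If
`y_{n₁−j} ≤ Λ_j` (`j ≤ n₁`, `Λ ≥ 0`) and `y_k ≤ F b^{-2γk}` (`k ≥ n₁`), then for `b > 1`, `γ > 0`:
`Σ_{k=n}^{N} y_k ≤ (n₁·(Σ_{j≤n₁} Λ_j)·b^{2γn₁} + F/(1 − b^{-2γ}))·b^{-2γn}`. [folklore] -/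
theorem forwardSourceSmoothing_tail_sum_le {y Λ : ℕ → ℝ} {b γ F : ℝ} {n₁ : ℕ} (hb : 1 < b)
    (hγ : 0 < γ) (hΛ : ∀ j, 0 ≤ Λ j) (hF : 0 ≤ F)
    (hnear : ∀ j, j ≤ n₁ → y (n₁ - j) ≤ Λ j)
    (hfar : ∀ k, n₁ ≤ k → y k ≤ F * b ^ (-(2 * γ * (k : ℝ)))) (n N : ℕ) :
    ∑ k ∈ Finset.Icc n N, y k ≤
      ((n₁ : ℝ) * (∑ j ∈ Finset.range (n₁ + 1), Λ j) * b ^ (2 * γ * (n₁ : ℝ)) +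
        F / (1 - b ^ (-(2 * γ)))) * b ^ (-(2 * γ * (n : ℝ))) := by
  have hb0 : 0 < b := by linarith
  set q : ℝ := b ^ (-(2 * γ)) with hq
  have hq0 : 0 ≤ q := Real.rpow_nonneg hb0.le _
  have hq1 : q < 1 := Real.rpow_lt_one_of_one_lt_of_neg hb (by linarith)
  have hqpow : ∀ k : ℕ, b ^ (-(2 * γ * (k : ℝ))) = q ^ k := fun k => by
    rw [hq, ← Real.rpow_mul_natCast hb0.le]; ring_nf
  set Λs : ℝ := ∑ j ∈ Finset.range (n₁ + 1), Λ j with hΛs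
  have hΛs0 : 0 ≤ Λs := Finset.sum_nonneg fun j _ => hΛ j
  have hΛle : ∀ j, j ≤ n₁ → Λ j ≤ Λs := fun j hj =>
    Finset.single_le_sum (fun i _ => hΛ i) (Finset.mem_range.2 (Nat.lt_succ_of_le hj))
  -- split the sum at the crossover
  rw [← Finset.sum_filter_add_sum_filter_not (Finset.Icc n N) (fun k => k < n₁)]
  -- near part
  have hnearsum : ∑ k ∈ (Finset.Icc n N).filter (fun k => k < n₁), y k ≤
      (n₁ : ℝ) * Λs * b ^ (2 * γ * (n₁ : ℝ)) * b ^ (-(2 * γ * (n : ℝ))) := by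
    rcases le_or_gt n₁ n with hn | hn
    · have hempty : (Finset.Icc n N).filter (fun k => k < n₁) = ∅ := by
        ext k; simp only [Finset.mem_filter, Finset.mem_Icc, Finset.notMem_empty, iff_false]; omega
      rw [hempty, Finset.sum_empty]
      have : 0 ≤ b ^ (2 * γ * (n₁ : ℝ)) * b ^ (-(2 * γ * (n : ℝ))) :=
        mul_nonneg (Real.rpow_nonneg hb0.le _) (Real.rpow_nonneg hb0.le _)
      nlinarith [mul_nonneg (mul_nonneg (Nat.cast_nonneg n₁) hΛs0) this]
    · have h1 : ∑ k ∈ (Finset.Icc n N).filter (fun k => k < n₁), y k ≤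
          ∑ _k ∈ (Finset.Icc n N).filter (fun k => k < n₁), Λs := by
        refine Finset.sum_le_sum fun k hk => ?_
        have hk' : k < n₁ := (Finset.mem_filter.1 hk).2
        have := hnear (n₁ - k) (by omega)
        rw [show n₁ - (n₁ - k) = k by omega] at this
        exact this.trans (hΛle _ (by omega))
      have hcard : (((Finset.Icc n N).filter (fun k => k < n₁)).card : ℝ) ≤ n₁ := by
        have : (Finset.Icc n N).filter (fun k => k < n₁) ⊆ Finset.range n₁ := by
          intro k hk; simp only [Finset.mem_filter, Finset.mem_Icc, Finset.mem_range] at hk ⊢; omega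
        exact_mod_cast (Finset.card_le_card this).trans_eq (Finset.card_range n₁)
      rw [Finset.sum_const, nsmul_eq_mul] at h1
      have h2 : (((Finset.Icc n N).filter (fun k => k < n₁)).card : ℝ) * Λs ≤ n₁ * Λs :=
        mul_le_mul_of_nonneg_right hcard hΛs0
      have h3 : 1 ≤ b ^ (2 * γ * (n₁ : ℝ)) * b ^ (-(2 * γ * (n : ℝ))) := by
        rw [← Real.rpow_add hb0]
        refine Real.one_le_rpow hb.le ?_
        have : (n : ℝ) ≤ n₁ := by exact_mod_cast hn.le
        nlinarith
      nlinarith [mul_nonneg (Nat.cast_nonneg n₁) hΛs0]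
  -- far part
  have hfarsum : ∑ k ∈ (Finset.Icc n N).filter (fun k => ¬ k < n₁), y k ≤
      F / (1 - q) * b ^ (-(2 * γ * (n : ℝ))) := by
    calc ∑ k ∈ (Finset.Icc n N).filter (fun k => ¬ k < n₁), y k
        ≤ ∑ k ∈ (Finset.Icc n N).filter (fun k => ¬ k < n₁), F * q ^ k :=
          Finset.sum_le_sum fun k hk => by
            rw [← hqpow]; exact hfar k (not_lt.1 (Finset.mem_filter.1 hk).2)
      _ ≤ ∑ k ∈ Finset.Icc n N, F * q ^ k :=
          Finset.sum_le_sum_of_subset_of_nonneg (Finset.filter_subset _ _)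
            fun k _ _ => mul_nonneg hF (pow_nonneg hq0 k)
      _ = F * ∑ k ∈ Finset.Ico n (N + 1), q ^ k := by
          rw [← Finset.mul_sum]; rfl
      _ ≤ F * (q ^ n / (1 - q)) :=
          mul_le_mul_of_nonneg_left (geom_sum_Ico_le_of_lt_one hq0 hq1) hF
      _ = F / (1 - q) * b ^ (-(2 * γ * (n : ℝ))) := by rw [hqpow]; ring
  linarith

end Summit.NavierStokesRegularity.NavierStokesRegularity.Theorems

end
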